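import Summits.MatrixMultiplication.MatrixMultiplication.Theorems.SoloInformedProjectiveDesignCount

/-!
# SoloInformedProjectiveDesignBound — matrix-multiplication designs in a finite projective plane are small

Solo-informed programme (MatrixMultiplication), gen 101.  Door D13 of the dossier is Conjecture 21 of
Cohn–Umans, *Fast matrix multiplication using coherent configurations* (SODA 2013, arXiv:1207.6528):
commutative coherent configurations of rank `n^{2+o(1)}` realizing `⟨n,n,n⟩` would give `ω = 2`.
This file settles the first natural candidate family negatively, by an elementary counting theorem
about finite projective planes (the counting lemmas are in `SoloInformedProjectiveDesignCount`;
only `Mathlib` is imported beneath).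

## The theorem

Let `inc : P → L → Prop` be a finite incidence structure in which every point lies on `q+1` lines,
two distinct points lie on exactly one common line, and there are `q²+q+1` lines (for instance a
projective plane of order `q`).  Call three maps `α β γ : Fin n × Fin n → P` a *design* if they are
injective and every pairwise-distinct collinear transversal `(α x, β y, γ z)` is MATCHED, i.e. writing
`x = (a,b')`, `y = (b,c')`, `z = (c,a')` one has `a = a'`, `b = b'`, `c = c'` (as a formula:
`y.1 = x.2 ∧ z = (y.2, x.1)`).  Then

* `design_bound` : `n ^ 2 < 65 * (q + 1)`;
* `projectivePlane_design_bound` : the same for Mathlib's abstract projective planes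
  (`Configuration.ProjectivePlane P L`, `q = ProjectivePlane.order P L`).

## Why this is the relevant hypothesis

The projective translation scheme `P_q = 𝒮(𝔽_q³, 𝔽_q^×)` (classes: the diagonal `R₀` and, for each
point `[d] ∈ PG(2,q)`, `R_[d] = {(u,v) : v - u ∈ 𝔽_q^× d}`) is a commutative association scheme of
rank `q²+q+2` on `q³` points.  Three point classes `R_[d], R_[d'], R_[d'']` with `[d],[d'],[d'']`
pairwise distinct support a triangle iff the three points are collinear (a relation
`λd + λ'd' + λ''d'' = 0` with all `λ`'s non-zero).  Hence a realization of `⟨n,n,n⟩` in `P_q` in the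
sense of Cohn–Umans (Def. 12: triangle ⟺ matched) whose three injections avoid `R₀` is a design in
`PG(2,q)`, and `design_bound` gives `n² < 65(q+1)`; an arbitrary realization uses `R₀` at most once
per injection, and deleting one index from each of the three index sets leaves a realization of
`⟨n-1,n-1,n-1⟩` by point classes, so `(n-1)² < 65(q+1)` in general.  Since `ω_s = 2` via the family
`P_q` would require `n² = q^{2-o(1)}` (rank `q²+q+2` versus `n³` products), the schemes `P_q` cannot
carry Conjecture 21; indeed the exponent bound they certify tends to `≥ 4`.  (Dossier claim c769,
sharpest-statement §2y.)

## Proof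

Second-moment method.  Let `a_L, b_L, c_L` be the numbers of `α`-, `β`-, `γ`-indices whose point
lies on the line `L`, and `S = ∑_L a_L b_L c_L` = the number of (index-)transversals together with a
common line.  UPPER (`sum_common₃_le`): a transversal with a common line is matched, or has two equal
points; this gives `S ≤ n³ + 3n⁴ + q n²`.  LOWER: `∑_L a_L = n²(q+1)` and `∑_L a_L² = n²(n²+q)`
(`moments`), so by Chebyshev (`card_sparse_le`) fewer than `4N/65` lines have `a_L ≤ μ/2`
(`μ = n²(q+1)/N`, `N = q²+q+1`, assuming `n² ≥ 65(q+1)`), and likewise for `b`, `c`; on the remaining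
`> 53N/65` lines `a_L b_L c_L > μ³/8`, whence `S > 53 n⁶ / (520 (q+1))`.  Comparing the two bounds
gives `n² < 40 (q+1)`, contradiction.
-/

namespace Summit.MatrixMultiplication.MatrixMultiplication.Theorems.ProjectiveDesign

open Finset

section Main

variable {P L : Type*} [Fintype L]
variable (inc : P → L → Prop) [DecidableRel inc]
variable {n : ℕ}

/-- CHEBYSHEV: few lines carry at most half the mean number of points of a colour. -/
lemma card_sparse_le {q : ℕ}
    (hthrough : ∀ p : P, (univ.filter (fun l => inc p l)).card = q + 1)
    (hcommon : ∀ p p' : P, p ≠ p' → (univ.filter (fun l => inc p l ∧ inc p' l)).card = 1)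
    (hcard : Fintype.card L = q ^ 2 + q + 1)
    (f : Fin n × Fin n → P) (hf : Function.Injective f) :
    ((univ.filter (fun l : L =>
        2 * (q ^ 2 + q + 1) * (univ.filter (fun x => inc (f x) l)).card < n ^ 2 * (q + 1))).card : ℝ)
        * ((n : ℝ) ^ 2) ^ 2 * ((q : ℝ) + 1) ^ 2
      ≤ 4 * ((q : ℝ) ^ 2 + q + 1) ^ 2 * (n : ℝ) ^ 2 * q := by
  obtain ⟨h1, h2⟩ := moments inc hthrough hcommon f hf
  set B := univ.filter (fun l : L =>
    2 * (q ^ 2 + q + 1) * (univ.filter (fun x => inc (f x) l)).card < n ^ 2 * (q + 1)) with hB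
  have h1r : ∑ l : L, ((univ.filter (fun x => inc (f x) l)).card : ℝ) = (n : ℝ) ^ 2 * (q + 1) := by exact_mod_cast h1
  have h2r : ∑ l : L, (((univ.filter (fun x => inc (f x) l)).card : ℝ)) ^ 2 =
      (n : ℝ) ^ 2 * ((n : ℝ) ^ 2 + q) := by exact_mod_cast h2
  have hcardr : ((Finset.univ : Finset L).card : ℝ) = (q : ℝ) ^ 2 + q + 1 := by
    rw [card_univ, hcard]; push_cast; ring
  -- the variance identity
  have hV : ∑ l : L,
      (((q : ℝ) ^ 2 + q + 1) * ((univ.filter (fun x => inc (f x) l)).card : ℝ) - (n : ℝ) ^ 2 * (q + 1)) ^ 2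
      = ((q : ℝ) ^ 2 + q + 1) ^ 2 * ((n : ℝ) ^ 2 * ((n : ℝ) ^ 2 + q))
        - 2 * ((q : ℝ) ^ 2 + q + 1) * ((n : ℝ) ^ 2 * (q + 1)) * ((n : ℝ) ^ 2 * (q + 1))
        + ((q : ℝ) ^ 2 + q + 1) * ((n : ℝ) ^ 2 * (q + 1)) ^ 2 := by
    have hexp : ∀ l : L,
        (((q : ℝ) ^ 2 + q + 1) * ((univ.filter (fun x => inc (f x) l)).card : ℝ) - (n : ℝ) ^ 2 * (q + 1)) ^ 2
        = ((q : ℝ) ^ 2 + q + 1) ^ 2 * ((univ.filter (fun x => inc (f x) l)).card : ℝ) ^ 2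
          - (2 * ((q : ℝ) ^ 2 + q + 1) * ((n : ℝ) ^ 2 * (q + 1))) * ((univ.filter (fun x => inc (f x) l)).card : ℝ)
          + ((n : ℝ) ^ 2 * (q + 1)) ^ 2 := fun l => by ring
    simp only [hexp, sum_add_distrib, sum_sub_distrib, ← mul_sum, h1r, h2r, sum_const, hcardr,
      nsmul_eq_mul]
  -- each sparse line contributes at least (m(q+1))²/4
  have hterm : ∀ l ∈ B, ((n : ℝ) ^ 2 * (q + 1)) ^ 2 ≤
      4 * (((q : ℝ) ^ 2 + q + 1) * ((univ.filter (fun x => inc (f x) l)).card : ℝ) - (n : ℝ) ^ 2 * (q + 1)) ^ 2 := by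
    intro l hl
    have hlt : 2 * (q ^ 2 + q + 1) * (univ.filter (fun x => inc (f x) l)).card < n ^ 2 * (q + 1) := (mem_filter.mp hl).2
    have hltr : (2 : ℝ) * ((q : ℝ) ^ 2 + q + 1) * ((univ.filter (fun x => inc (f x) l)).card : ℝ) <
        (n : ℝ) ^ 2 * (q + 1) := by
      exact_mod_cast hlt
    have hnn : (0 : ℝ) ≤ ((q : ℝ) ^ 2 + q + 1) * ((univ.filter (fun x => inc (f x) l)).card : ℝ) := by positivity
    nlinarith [hltr, hnn]
  have hsumB : (B.card : ℝ) * ((n : ℝ) ^ 2 * (q + 1)) ^ 2 ≤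
      4 * (((q : ℝ) ^ 2 + q + 1) ^ 2 * ((n : ℝ) ^ 2 * ((n : ℝ) ^ 2 + q))
        - 2 * ((q : ℝ) ^ 2 + q + 1) * ((n : ℝ) ^ 2 * (q + 1)) * ((n : ℝ) ^ 2 * (q + 1))
        + ((q : ℝ) ^ 2 + q + 1) * ((n : ℝ) ^ 2 * (q + 1)) ^ 2) := by
    calc (B.card : ℝ) * ((n : ℝ) ^ 2 * (q + 1)) ^ 2
        = ∑ l ∈ B, ((n : ℝ) ^ 2 * (q + 1)) ^ 2 := by rw [sum_const, nsmul_eq_mul]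
      _ ≤ ∑ l ∈ B,
          4 * (((q : ℝ) ^ 2 + q + 1) * ((univ.filter (fun x => inc (f x) l)).card : ℝ) - (n : ℝ) ^ 2 * (q + 1)) ^ 2 :=
          sum_le_sum hterm
      _ ≤ ∑ l : L,
          4 * (((q : ℝ) ^ 2 + q + 1) * ((univ.filter (fun x => inc (f x) l)).card : ℝ) - (n : ℝ) ^ 2 * (q + 1)) ^ 2 :=
          sum_le_sum_of_subset_of_nonneg (subset_univ B) (fun l _ _ => by positivity)
      _ = _ := by rw [← mul_sum, hV]
  have hpos : (0 : ℝ) ≤ ((q : ℝ) ^ 2 + q + 1) * ((n : ℝ) ^ 2) ^ 2 * q := by positivity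
  nlinarith [hsumB, hpos]

variable [DecidableEq P]

/-- THE THEOREM.  In a finite incidence structure with `q+1` lines through every point, exactly one
line through any two distinct points and `q²+q+1` lines (e.g. a projective plane of order `q`),
three injective maps `α β γ : Fin n × Fin n → P` whose pairwise-distinct collinear transversals
`(α x, β y, γ z)` are all matched (`x = (a,b')`, `y = (b,c')`, `z = (c,a')` with `a = a'`, `b = b'`,
`c = c'`, i.e. `y.1 = x.2 ∧ z = (y.2, x.1)`) force `n² < 65 (q+1)`.  This is the hypothesis a
realization of `⟨n,n,n⟩` (Cohn–Umans 2013, Def. 12) in the projective translation scheme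
`𝒮(𝔽_q³, 𝔽_q^×)` provides. -/
theorem design_bound {q : ℕ}
    (hthrough : ∀ p : P, (univ.filter (fun l => inc p l)).card = q + 1)
    (hcommon : ∀ p p' : P, p ≠ p' → (univ.filter (fun l => inc p l ∧ inc p' l)).card = 1)
    (hcard : Fintype.card L = q ^ 2 + q + 1)
    (α β γ : Fin n × Fin n → P) (hα : Function.Injective α) (hβ : Function.Injective β)
    (hγ : Function.Injective γ)
    (hreal : ∀ x y z : Fin n × Fin n, α x ≠ β y → β y ≠ γ z → α x ≠ γ z →
        (∃ l, inc (α x) l ∧ inc (β y) l ∧ inc (γ z) l) → (y.1 = x.2 ∧ z = (y.2, x.1))) :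
    n ^ 2 < 65 * (q + 1) := by
  by_contra hcon'
  have hcon : 65 * (q + 1) ≤ n ^ 2 := not_lt.mp hcon'
  classical
  have hn : 1 ≤ n := by
    rcases Nat.eq_zero_or_pos n with h | h
    · subst h; simp at hcon
    · exact h
  -- the triple count S and its upper bound
  set S := ∑ l : L, (univ.filter (fun x => inc (α x) l)).card * (univ.filter (fun x => inc (β x) l)).card
    * (univ.filter (fun x => inc (γ x) l)).card with hS
  have hU : S ≤ n ^ 3 + 3 * n ^ 4 + q * n ^ 2 := by
    rw [hS, sum_cnt_mul_cnt_mul_cnt]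
    exact sum_common₃_le inc hthrough hcommon α β γ hβ hγ hreal
  -- sparse lines per colour (Chebyshev) and good lines
  have hBα := card_sparse_le inc hthrough hcommon hcard α hα
  have hBβ := card_sparse_le inc hthrough hcommon hcard β hβ
  have hBγ := card_sparse_le inc hthrough hcommon hcard γ hγ
  set Bα := univ.filter (fun l : L =>
    2 * (q ^ 2 + q + 1) * (univ.filter (fun x => inc (α x) l)).card < n ^ 2 * (q + 1)) with hBαd
  set Bβ := univ.filter (fun l : L =>
    2 * (q ^ 2 + q + 1) * (univ.filter (fun x => inc (β x) l)).card < n ^ 2 * (q + 1)) with hBβd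
  set Bγ := univ.filter (fun l : L =>
    2 * (q ^ 2 + q + 1) * (univ.filter (fun x => inc (γ x) l)).card < n ^ 2 * (q + 1)) with hBγd
  set G := univ.filter (fun l : L => n ^ 2 * (q + 1) ≤ 2 * (q ^ 2 + q + 1) * (univ.filter (fun x => inc (α x) l)).card ∧
    n ^ 2 * (q + 1) ≤ 2 * (q ^ 2 + q + 1) * (univ.filter (fun x => inc (β x) l)).card ∧
    n ^ 2 * (q + 1) ≤ 2 * (q ^ 2 + q + 1) * (univ.filter (fun x => inc (γ x) l)).card) with hGd
  have hGcard : q ^ 2 + q + 1 ≤ G.card + (Bα.card + Bβ.card + Bγ.card) := by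
    have hsup : univ \ (Bα ∪ Bβ ∪ Bγ) ⊆ G := by
      intro l hl
      simp only [mem_sdiff, mem_univ, true_and, mem_union, not_or, hBαd, hBβd, hBγd, mem_filter,
        not_lt] at hl
      simp only [hGd, mem_filter, mem_univ, true_and]
      exact ⟨hl.1.1, hl.1.2, hl.2⟩
    have h1 := card_le_card hsup
    have h2 := Finset.card_le_card_sdiff_add_card (s := (univ : Finset L)) (t := Bα ∪ Bβ ∪ Bγ)
    have h3 : (Bα ∪ Bβ ∪ Bγ).card ≤ Bα.card + Bβ.card + Bγ.card :=
      (card_union_le _ _).trans (Nat.add_le_add_right (card_union_le _ _) _)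
    rw [card_univ, hcard] at h2
    exact h2.trans (Nat.add_le_add h1 h3)
  -- lower bound on the triple count from the good lines
  have hLow : G.card * (n ^ 2 * (q + 1)) ^ 3 ≤ 8 * (q ^ 2 + q + 1) ^ 3 * S := by
    calc G.card * (n ^ 2 * (q + 1)) ^ 3 = ∑ l ∈ G, (n ^ 2 * (q + 1)) ^ 3 := by
          rw [sum_const, smul_eq_mul]
      _ ≤ ∑ l ∈ G, (2 * (q ^ 2 + q + 1)) ^ 3 * ((univ.filter (fun x => inc (α x) l)).card
            * (univ.filter (fun x => inc (β x) l)).card * (univ.filter (fun x => inc (γ x) l)).card) := by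
          refine sum_le_sum (fun l hl => ?_)
          obtain ⟨h1, h2, h3⟩ := (mem_filter.mp hl).2
          calc (n ^ 2 * (q + 1)) ^ 3 = (n ^ 2 * (q + 1)) * (n ^ 2 * (q + 1)) * (n ^ 2 * (q + 1)) := by
                ring
            _ ≤ (2 * (q ^ 2 + q + 1) * (univ.filter (fun x => inc (α x) l)).card)
                  * (2 * (q ^ 2 + q + 1) * (univ.filter (fun x => inc (β x) l)).card)
                  * (2 * (q ^ 2 + q + 1) * (univ.filter (fun x => inc (γ x) l)).card) :=
                Nat.mul_le_mul (Nat.mul_le_mul h1 h2) h3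
            _ = (2 * (q ^ 2 + q + 1)) ^ 3 * ((univ.filter (fun x => inc (α x) l)).card
                  * (univ.filter (fun x => inc (β x) l)).card * (univ.filter (fun x => inc (γ x) l)).card) := by
                ring
      _ ≤ ∑ l : L, (2 * (q ^ 2 + q + 1)) ^ 3 * ((univ.filter (fun x => inc (α x) l)).card
            * (univ.filter (fun x => inc (β x) l)).card * (univ.filter (fun x => inc (γ x) l)).card) :=
          sum_le_sum_of_subset_of_nonneg (subset_univ G) (fun l _ _ => Nat.zero_le _)
      _ = 8 * (q ^ 2 + q + 1) ^ 3 * S := by rw [hS, ← mul_sum]; ring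
  -- pass to ℝ
  have hconr : (65 : ℝ) * ((q : ℝ) + 1) ≤ (n : ℝ) ^ 2 := by exact_mod_cast hcon
  have hUr : (S : ℝ) ≤ (n : ℝ) ^ 3 + 3 * (n : ℝ) ^ 4 + q * (n : ℝ) ^ 2 := by exact_mod_cast hU
  have hGr : (q : ℝ) ^ 2 + q + 1 ≤ (G.card : ℝ) + ((Bα.card : ℝ) + Bβ.card + Bγ.card) := by
    exact_mod_cast hGcard
  have hLowr : (G.card : ℝ) * ((n : ℝ) ^ 2 * ((q : ℝ) + 1)) ^ 3
      ≤ 8 * ((q : ℝ) ^ 2 + q + 1) ^ 3 * (S : ℝ) := by exact_mod_cast hLow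
  have hq0 : (0 : ℝ) ≤ q := Nat.cast_nonneg q
  have hq1 : (0 : ℝ) < (q : ℝ) + 1 := by positivity
  have hn0 : (0 : ℝ) ≤ (n : ℝ) := Nat.cast_nonneg n
  have hn1 : (1 : ℝ) ≤ n := by exact_mod_cast hn
  have hm0 : (0 : ℝ) < (n : ℝ) ^ 2 := by positivity
  have hNle : (q : ℝ) ^ 2 + q + 1 ≤ ((q : ℝ) + 1) ^ 2 := by nlinarith
  have hNpos : (0 : ℝ) < (q : ℝ) ^ 2 + q + 1 := by positivity
  have hS0 : (0 : ℝ) ≤ (S : ℝ) := Nat.cast_nonneg _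
  -- each sparse set is small: 65 |B| (q+1) ≤ 4 N q
  have small : ∀ b : ℝ, 0 ≤ b →
      b * ((n : ℝ) ^ 2) ^ 2 * ((q : ℝ) + 1) ^ 2 ≤ 4 * ((q : ℝ) ^ 2 + q + 1) ^ 2 * (n : ℝ) ^ 2 * q →
      65 * b * ((q : ℝ) + 1) ≤ 4 * ((q : ℝ) ^ 2 + q + 1) * q := by
    intro b hb h
    by_contra hc'
    have hc := not_le.mp hc'
    have hpos2 : (0 : ℝ) < (n : ℝ) ^ 2 * ((q : ℝ) + 1) ^ 2 := by positivity
    have c1 : (0 : ℝ) ≤ b * (n : ℝ) ^ 2 * ((q : ℝ) + 1) ^ 2 := by positivity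
    have e1 := mul_le_mul_of_nonneg_left hconr c1
    have c2 : (0 : ℝ) ≤ 4 * ((q : ℝ) ^ 2 + q + 1) * (n : ℝ) ^ 2 * q := by positivity
    have e2 := mul_le_mul_of_nonneg_left hNle c2
    have e3 := mul_lt_mul_of_pos_right hc hpos2
    linarith [e1, e2, e3, h]
  have sα := small _ (Nat.cast_nonneg _) hBα
  have sβ := small _ (Nat.cast_nonneg _) hBβ
  have sγ := small _ (Nat.cast_nonneg _) hBγ
  -- hence 65 |G| ≥ 53 N
  have hG53 : 53 * ((q : ℝ) ^ 2 + q + 1) ≤ 65 * (G.card : ℝ) := by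
    have c1 : (0 : ℝ) ≤ 65 * ((q : ℝ) + 1) := by positivity
    have e1 := mul_le_mul_of_nonneg_left hGr c1
    have h53 : 53 * ((q : ℝ) ^ 2 + q + 1) * ((q : ℝ) + 1) ≤ 65 * (G.card : ℝ) * ((q : ℝ) + 1) := by
      linarith [e1, sα, sβ, sγ, hNpos, hq0]
    exact le_of_mul_le_mul_right h53 hq1
  -- lower bound: 53 n⁶ ≤ 520 (q+1) S
  have hL2 : 53 * ((n : ℝ) ^ 2) ^ 3 ≤ 520 * ((q : ℝ) + 1) * S := by
    have c0 : (0 : ℝ) ≤ ((n : ℝ) ^ 2 * ((q : ℝ) + 1)) ^ 3 := by positivity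
    have e0 := mul_le_mul_of_nonneg_right hG53 c0
    have e1 : 53 * ((n : ℝ) ^ 2 * ((q : ℝ) + 1)) ^ 3 * ((q : ℝ) ^ 2 + q + 1)
        ≤ 520 * ((q : ℝ) ^ 2 + q + 1) ^ 2 * S * ((q : ℝ) ^ 2 + q + 1) := by
      linarith [hLowr, e0]
    have e2 := le_of_mul_le_mul_right e1 hNpos
    have e3 : ((q : ℝ) ^ 2 + q + 1) ^ 2 ≤ (((q : ℝ) + 1) ^ 2) ^ 2 := by
      have f1 := mul_le_mul_of_nonneg_left hNle hNpos.le
      have f2 := mul_le_mul_of_nonneg_right hNle (by positivity : (0 : ℝ) ≤ ((q : ℝ) + 1) ^ 2)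
      nlinarith [f1, f2]
    have c4 : (0 : ℝ) ≤ 520 * (S : ℝ) := by linarith [hS0]
    have e4 := mul_le_mul_of_nonneg_left e3 c4
    have hq3 : (0 : ℝ) < ((q : ℝ) + 1) ^ 3 := by positivity
    have e5 : 53 * ((n : ℝ) ^ 2) ^ 3 * ((q : ℝ) + 1) ^ 3
        ≤ 520 * ((q : ℝ) + 1) * S * ((q : ℝ) + 1) ^ 3 := by
      linarith [e2, e4]
    exact le_of_mul_le_mul_right e5 hq3
  -- upper bound: 65 S ≤ 261 n⁴
  have hU2 : 65 * (S : ℝ) ≤ 261 * ((n : ℝ) ^ 2) ^ 2 := by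
    have e1 : (n : ℝ) ^ 3 ≤ (n : ℝ) ^ 4 := by
      have := mul_le_mul_of_nonneg_left hn1 (pow_nonneg hn0 3)
      linarith [this]
    have hqm : 65 * (q : ℝ) ≤ (n : ℝ) ^ 2 := by linarith
    have e2 := mul_le_mul_of_nonneg_right hqm hm0.le
    linarith [hUr, e1, e2]
  -- combine: 53 n⁶ ≤ 2088 (q+1) n⁴ < 53 · 65 (q+1) n⁴ ≤ 53 n⁶
  have c8 : (0 : ℝ) ≤ 8 * ((q : ℝ) + 1) := by positivity
  have e8 := mul_le_mul_of_nonneg_left hU2 c8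
  have hfin : 53 * ((n : ℝ) ^ 2) ^ 3 ≤ 2088 * ((q : ℝ) + 1) * ((n : ℝ) ^ 2) ^ 2 := by
    linarith [hL2, e8]
  have c53 : (0 : ℝ) ≤ 53 * ((n : ℝ) ^ 2) ^ 2 := by positivity
  have e53 := mul_le_mul_of_nonneg_left hconr c53
  have hposM : (0 : ℝ) < ((n : ℝ) ^ 2) ^ 2 * ((q : ℝ) + 1) := by positivity
  linarith [hfin, e53, hposM]


end Main

section ProjectivePlane

/-! ### Specialisation to an abstract projective plane (Mathlib's `Configuration.ProjectivePlane`) -/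

variable {P L : Type*} [Membership P L] [Configuration.ProjectivePlane P L] [Fintype P] [Fintype L]
  [DecidableEq P] {n : ℕ}

/-- In a finite projective plane of order `q`, three injective maps `α β γ : Fin n × Fin n → P` all of
whose pairwise-distinct collinear transversals are matched satisfy `n² < 65 (q+1)`.  For the
Desarguesian plane `PG(2,q)` this is the statement that the projective translation scheme
`𝒮(𝔽_q³, 𝔽_q^×)` realizes `⟨n,n,n⟩` by point classes only if `n² < 65 (q+1)` (and in general only
if `(n-1)² < 65 (q+1)`, discarding the at most one index per map sent to the diagonal class). -/
theorem projectivePlane_design_bound (α β γ : Fin n × Fin n → P)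
    (hα : Function.Injective α) (hβ : Function.Injective β) (hγ : Function.Injective γ)
    (hreal : ∀ x y z : Fin n × Fin n, α x ≠ β y → β y ≠ γ z → α x ≠ γ z →
        (∃ l : L, α x ∈ l ∧ β y ∈ l ∧ γ z ∈ l) → (y.1 = x.2 ∧ z = (y.2, x.1))) :
    n ^ 2 < 65 * (Configuration.ProjectivePlane.order P L + 1) := by
  classical
  refine design_bound (fun (p : P) (l : L) => p ∈ l) ?_ ?_
    (Configuration.ProjectivePlane.card_lines P L) α β γ hα hβ hγ hreal
  · intro p
    rw [← Configuration.ProjectivePlane.lineCount_eq L p, Configuration.lineCount,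
      Nat.card_eq_fintype_card, Fintype.card_subtype]
  · intro p p' hpp
    rw [Finset.card_eq_one]
    refine ⟨Configuration.HasLines.mkLine hpp, ?_⟩
    ext l
    simp only [mem_filter, mem_univ, true_and, mem_singleton]
    constructor
    · rintro ⟨h1, h2⟩
      obtain ⟨m1, m2⟩ := Configuration.HasLines.mkLine_ax (L := L) hpp
      exact (Configuration.Nondegenerate.eq_or_eq h1 h2 m1 m2).resolve_left hpp
    · rintro rfl
      exact Configuration.HasLines.mkLine_ax hpp

end ProjectivePlane

end Summit.MatrixMultiplication.MatrixMultiplication.Theorems.ProjectiveDesign
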